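import Literature.Barriers.ABC.BakerMethodBounds

/-!
# Barrier (ABC), companion: the `ε`-shape `log c ≪_ε rad(abc)^{θ₀+ε}` and two named rungs below Stewart–Yu 1991

`Literature/Barriers/ABC/BakerMethodBoundsEpsShape.lean` — the one-parameter family of statements of which
`Literature.Barriers.ABC.stewartYu1991_upperBound` is the member `θ₀ = 2/3` (Waldschmidt 2014, §2, quoting Stewart–Yu,
Math. Ann. 291 (1991): "for every `ε > 0` and `c` sufficiently large in terms of `ε`, `log c ≤ κ(ε) R^{2/3+ε}`"), its
monotonicity in `θ₀`, and the two WEAKER members `θ₀ = 3, 4` as named closed statements (`EpsShapeBoundThree`,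
`EpsShapeBoundFour`).  The weaker members are consequences of the 1991 theorem (`epsShapeBoundFour_of_stewartYu1991`,
proved here) and serve as intermediate rungs (alternative closers, D-0061) for routes that re-derive abc-type bounds from
`p`-adic linear forms in logarithms of principal units with a constant `n^{κn}`, `κ = 3, 4`
[cite: StewartYu1991, main theorem, as quoted in Waldschmidt2014 §2] [cite: Waldschmidt2014, §2].

WHAT THIS IS NOT: no new bound is proved; `EpsShapeBoundThree/Four` are open here exactly as `stewartYu1991_upperBound` is
(named statements), and only the implications between them are theorems.
-/

namespace Literature.Barriers.ABC

open Literature.NumberTheory.DiophantineGeometry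

/-- **Baker `ε`-shape with exponent `θ₀`**: for every `ε > 0` there are `κ, c₀` such that every abc triple with `c ≥ c₀`
satisfies `log c ≤ κ · rad(abc)^{θ₀ + ε}` (`^` = `Real.rpow`).  At `θ₀ = 2/3` this is, verbatim,
`stewartYu1991_upperBound`. [cite: StewartYu1991, main theorem, as quoted in Waldschmidt2014 §2] -/
def EpsShapeBound (θ₀ : ℝ) : Prop :=
  ∀ ε : ℝ, 0 < ε → ∃ κ c₀ : ℝ, ∀ a b c : ℕ, IsABCTriple a b c → c₀ ≤ (c : ℝ) →
    Real.log c ≤ κ * (rad a b c : ℝ) ^ (θ₀ + ε : ℝ)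

/-- `stewartYu1991_upperBound` is literally `EpsShapeBound (2/3)`. [cite: StewartYu1991, main theorem, as quoted in Waldschmidt2014 §2] -/
theorem stewartYu1991_iff_epsShapeBound : stewartYu1991_upperBound ↔ EpsShapeBound (2 / 3) := Iff.rfl

/-- Monotonicity of the `ε`-shape in the exponent (`rad ≥ 1`). [cite: Waldschmidt2014, §2] -/
theorem epsShapeBound_mono {θ θ' : ℝ} (hle : θ ≤ θ') (h : EpsShapeBound θ) : EpsShapeBound θ' := by
  intro ε hε
  obtain ⟨κ, c₀, hκ⟩ := h ε hε
  refine ⟨|κ|, c₀, fun a b c ht hc => ?_⟩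
  have h1 := hκ a b c ht hc
  have hR : (1 : ℝ) ≤ (rad a b c : ℝ) := one_le_rad_real a b c
  have hR0 : 0 ≤ (rad a b c : ℝ) ^ (θ + ε : ℝ) := Real.rpow_nonneg (by linarith) _
  calc Real.log c ≤ κ * (rad a b c : ℝ) ^ (θ + ε : ℝ) := h1
    _ ≤ |κ| * (rad a b c : ℝ) ^ (θ + ε : ℝ) := mul_le_mul_of_nonneg_right (le_abs_self κ) hR0
    _ ≤ |κ| * (rad a b c : ℝ) ^ (θ' + ε : ℝ) :=
        mul_le_mul_of_nonneg_left (Real.rpow_le_rpow_of_exponent_le hR (by linarith)) (abs_nonneg κ)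

/-- **Rung `rad^{4+ε}`**: for every `ε > 0`, `log c ≤ κ(ε) · rad(abc)^{4+ε}` for `c ≥ c₀(ε)` — the member `θ₀ = 4`,
a consequence of Stewart–Yu 1991 (`epsShapeBoundFour_of_stewartYu1991`), named as a closed statement.
[cite: StewartYu1991, main theorem, as quoted in Waldschmidt2014 §2] -/
def EpsShapeBoundFour : Prop := EpsShapeBound 4

/-- **Rung `rad^{3+ε}`**: the member `θ₀ = 3`, likewise a consequence of Stewart–Yu 1991.
[cite: StewartYu1991, main theorem, as quoted in Waldschmidt2014 §2] -/
def EpsShapeBoundThree : Prop := EpsShapeBound 3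

/-- Unfolding lemma. [cite: Waldschmidt2014, §2] -/
theorem epsShapeBoundFour_iff : EpsShapeBoundFour ↔ EpsShapeBound 4 := Iff.rfl

/-- Unfolding lemma. [cite: Waldschmidt2014, §2] -/
theorem epsShapeBoundThree_iff : EpsShapeBoundThree ↔ EpsShapeBound 3 := Iff.rfl

/-- The rung `rad^{3+ε}` gives the rung `rad^{4+ε}`. [cite: Waldschmidt2014, §2] -/
theorem epsShapeBoundFour_of_three (h : EpsShapeBoundThree) : EpsShapeBoundFour :=
  epsShapeBound_mono (by norm_num) h

/-- Stewart–Yu 1991 gives the rung `rad^{3+ε}`. [cite: Waldschmidt2014, §2] -/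
theorem epsShapeBoundThree_of_stewartYu1991 (h : stewartYu1991_upperBound) : EpsShapeBoundThree :=
  epsShapeBound_mono (by norm_num) (stewartYu1991_iff_epsShapeBound.mp h)

/-- Stewart–Yu 1991 gives the rung `rad^{4+ε}`. [cite: Waldschmidt2014, §2] -/
theorem epsShapeBoundFour_of_stewartYu1991 (h : stewartYu1991_upperBound) : EpsShapeBoundFour :=
  epsShapeBoundFour_of_three (epsShapeBoundThree_of_stewartYu1991 h)

/-- Conversely any `ε`-shape with `θ₀ ≤ 2/3` gives Stewart–Yu 1991. [cite: Waldschmidt2014, §2] -/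
theorem stewartYu1991_of_epsShapeBound {θ₀ : ℝ} (hθ : θ₀ ≤ 2 / 3) (h : EpsShapeBound θ₀) :
    stewartYu1991_upperBound :=
  stewartYu1991_iff_epsShapeBound.mpr (epsShapeBound_mono hθ h)

/-- **Rung `rad^{5/2+ε}`**: the member `θ₀ = 5/2`, likewise a consequence of Stewart–Yu 1991 (`2/3 ≤ 5/2`); named as
a closed statement to serve as the alternative closer between `EpsShapeBoundThree` and the member `θ₀ = 2` (the
principal-unit route reaches it with a constant `n^{κn}`, `κ = 5/2`, when Mahler's basis theorem is run in the Euclidean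
norm). [cite: StewartYu1991, main theorem, as quoted in Waldschmidt2014 §2] -/
def EpsShapeBoundFiveHalves : Prop := EpsShapeBound (5 / 2)

/-- Unfolding lemma. [cite: Waldschmidt2014, §2] -/
theorem epsShapeBoundFiveHalves_iff : EpsShapeBoundFiveHalves ↔ EpsShapeBound (5 / 2) := Iff.rfl

/-- The rung `rad^{5/2+ε}` gives the rung `rad^{3+ε}`. [cite: Waldschmidt2014, §2] -/
theorem epsShapeBoundThree_of_fiveHalves (h : EpsShapeBoundFiveHalves) : EpsShapeBoundThree :=
  epsShapeBound_mono (by norm_num) h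

/-- Stewart–Yu 1991 gives the rung `rad^{5/2+ε}`. [cite: Waldschmidt2014, §2] -/
theorem epsShapeBoundFiveHalves_of_stewartYu1991 (h : stewartYu1991_upperBound) : EpsShapeBoundFiveHalves :=
  epsShapeBound_mono (by norm_num) (stewartYu1991_iff_epsShapeBound.mp h)

/-- **Rung `rad^{1+ε}`**: the member `θ₀ = 1`, likewise a consequence of Stewart–Yu 1991 (`2/3 ≤ 1`); named as a
closed statement to serve as the alternative closer reached by Yu's 1990 bound at the ODD primes alone (one-prime
bound `(c·n)^n · p²`, `κ = 1`, through the odd `κ`-door), one step above Stewart–Yu 1991's `2/3`.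
[cite: StewartYu1991, main theorem, as quoted in Waldschmidt2014 §2] -/
def EpsShapeBoundOne : Prop := EpsShapeBound 1

/-- Unfolding lemma. [cite: Waldschmidt2014, §2] -/
theorem epsShapeBoundOne_iff : EpsShapeBoundOne ↔ EpsShapeBound 1 := Iff.rfl

/-- The rung `rad^{1+ε}` gives the rung `rad^{5/2+ε}`. [cite: Waldschmidt2014, §2] -/
theorem epsShapeBoundFiveHalves_of_one (h : EpsShapeBoundOne) : EpsShapeBoundFiveHalves :=
  epsShapeBound_mono (by norm_num) h

/-- The rung `rad^{1+ε}` gives the rung `rad^{3+ε}`. [cite: Waldschmidt2014, §2] -/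
theorem epsShapeBoundThree_of_one (h : EpsShapeBoundOne) : EpsShapeBoundThree :=
  epsShapeBound_mono (by norm_num) h

/-- Stewart–Yu 1991 gives the rung `rad^{1+ε}`. [cite: Waldschmidt2014, §2] -/
theorem epsShapeBoundOne_of_stewartYu1991 (h : stewartYu1991_upperBound) : EpsShapeBoundOne :=
  epsShapeBound_mono (by norm_num) (stewartYu1991_iff_epsShapeBound.mp h)

end Literature.Barriers.ABC
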